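import Summits.BirchSwinnertonDyer.BirchSwinnertonDyer.Theorems.EisensteinPrimesResidualDevissageCountNonsplitIdentity
import HarnessLib

/-!
# Hypothesis (L) for free at a NON-SPLIT multiplicative Eisenstein prime: `E_K[p^∞]^{G_{K_{∞,v̄}}}` has no `p`-torsion, so the
# residual λ-count there is conditional on CGLS22 Prop. 14 ALONE (cell `bsd-eis`, seat `bsd-line-x2-p2` gen 5, D-0154 KEY row 5;
# crux 4 `BSDpOnCellC` line b1; sequel of `…ResidualDevissageCountNonsplitIdentity`)

HONEST FRAMING (cell `bsd-eis`, run/shared/lean/pub/bsd-eis/): bookkeeping on constructed objects plus the PROVED local fact p626493 §1;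
no definition, no named fact, no `sorry`, no `Theses` import; nothing about BSD or a main conjecture is asserted; nothing booked; no
label or count moves. Helper `--supports stmt-BirchSwinnertonDyer-19034`; closes no stub.

The Kummer comparison `#R_𝔭^Σ(K_∞, E[p]) = #Sel_𝔭^Σ(K_∞, E[p^∞])[p]` (UTD) carries hypothesis (L): no non-zero `p`-torsion point of
`E[p^∞]` fixed by `ker κ ⊓ D_𝔭`. At a NON-SPLIT multiplicative odd Eisenstein prime both Jordan–Hölder characters of `E[p]|_{D_{v̄}}`
are non-trivial of order prime to `p` (twisted Tate uniformisation, p626493 §1), hence stay non-trivial on the pro-`p` co-kernel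
`ker κ ⊓ D_{v̄}` (CHL `TowerFixed`), so `E_K[p]^{ker κ ⊓ D_{v̄}} = 0` and (L) holds:

* §1 `noFixedPTorsion_of_forall_fixed_torsion_eq_zero` — (L) for a subgroup `D` follows from «`E[p]` has no non-zero `D`-fixed
  point» (a `D`-fixed `m ∈ E[p^∞]` with `p m = 0` is a `D`-fixed point of `E[p]`); `forall_fixed_torsion_eq_zero_of_stableSubgroup` —
  «no fixed point in `E[p]`» from «none in `S` and none in `E[p]/S`» for a stable `S ≤ E[p]`.
* §2 `exists_stableSubgroup_noFixed_sub_quot_of_not_split` — at a non-split multiplicative odd Eisenstein prime (`K` imaginary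
  quadratic, `(p)` split, `v̄ ∣ p`, any `κ`): the base-changed rational line `S` has NO non-zero `ker κ ⊓ D_{v̄}`-fixed vector in
  `S` NOR in `E_K[p]/S`; **`noFixedPTorsion_of_not_split`**: (L) at `v̄`.
* §3 **`pow_lambdaInvariant_mul_le_and_eq_of_prop14_of_not_split'`** — file 5 §3 with (L) discharged: at every non-split
  multiplicative Eisenstein datum of Keller–Yin Lemma 5.1.1, CGLS22 Prop. 14 [PUB] ALONE gives
  `p^{λ(X^{Sf})} · #X^{Sf}[p] ≤ #R(S) · #R(E_K[p]/S)`, and `=` given the residual surjectivity.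

References: [KellerYin2024] Thm. 1.4.1, Lemma 5.1.1 (arXiv:2402.12781v2); [CastellaGrossiLeeSkinner2022] Prop. 14, Thm. 3.2.1 (arXiv:2008.02571);
[GreenbergVatsal2000] §2 pp. 14–15, 26–28; [SilvermanATAEC1994] V.5.3–5.4; [SerreGaloisCohomology1997] I.§1.4; cell p626493 (g4),
p636269, UTD `…ResidualSelmerExact`.
-/

set_option autoImplicit false
set_option linter.dupNamespace false -- the summit namespace `…BirchSwinnertonDyer.BirchSwinnertonDyer.Theorems` (Sub = Summit, D-0017) trips it

noncomputable section

open scoped Classical Pointwise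

namespace Summit.BirchSwinnertonDyer.BirchSwinnertonDyer.Theorems.ResidualDevissageNonsplitLocal

open WeierstrassCurve NumberField IsDedekindDomain Field
  Literature.NumberTheory.EllipticCurves Literature.NumberTheory.EllipticCurves.IwasawaAlgebra
  Literature.NumberTheory.EllipticCurves.GreenbergSelmer
  Literature.NumberTheory.EllipticCurves.GreenbergVatsal2000
  Literature.NumberTheory.GaloisRepresentations IsDedekindDomain.HeightOneSpectrum
  Literature.NumberTheory.EllipticCurves.Rank1Residual
  Summit.BirchSwinnertonDyer.Rank1Residual.X11b Summit.BirchSwinnertonDyer.Rank1Residual.X11b.AcSelmer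
  Summit.BirchSwinnertonDyer.Rank1Residual.X2.ResidualDevissageModules
  Summit.BirchSwinnertonDyer.BirchSwinnertonDyer.Theorems
  Summit.BirchSwinnertonDyer.BirchSwinnertonDyer.Theorems.ResidualDevissageCountNonsplit
  Summit.BirchSwinnertonDyer.BirchSwinnertonDyer.Theorems.ResidualDevissageCountNonsplitIdentity
  Summit.BirchSwinnertonDyer.BirchSwinnertonDyer.Theorems.CumulativeHeegnerInclusionAtThreeResidualDevissage
  Summit.BirchSwinnertonDyer.BirchSwinnertonDyer.Theorems.CumulativeHeegnerInclusionAtThreeLineBaseChange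
  Summit.BirchSwinnertonDyer.BirchSwinnertonDyer.Theorems.CumulativeHeegnerInclusionAtThreeTowerFixed
  Summit.BirchSwinnertonDyer.BirchSwinnertonDyer.Theorems.CumulativeHeegnerInclusionAtThreeStubB1LineDeterminant
  Summit.BirchSwinnertonDyer.BirchSwinnertonDyer.Theorems.CumulativeHeegnerInclusionAtThreeBadPlaces
  Summit.BirchSwinnertonDyer.BirchSwinnertonDyer.Theorems.AdditiveKoly.SplitCompletion
  Summit.BirchSwinnertonDyer.BirchSwinnertonDyer.Theorems.KellerYinLemma511NonsplitOfPrint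
open Literature.NumberTheory.EllipticCurves.CastellaGrossiLeeSkinner2022 (prop14_residualCharacterSelmer_finite)

/-! ### §1 (L) from «no fixed point of `E[p]`» -/

section Fixed

variable {K : Type} [Field K] [NumberField K] (W : WeierstrassCurve K) {p : ℕ} [Fact p.Prime]

omit [NumberField K] [Fact p.Prime] in
/-- **(L) from «`E[p]^D = 0`»**: if no non-zero point of `E[p]` is fixed by the subgroup `D ≤ Γ_K`, then no non-zero `p`-torsion
element of `E[p^∞]` is fixed by `D` (such an element IS a point of `E[p]`). [cite: GreenbergVatsal2000, §2 p. 26] -/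
theorem noFixedPTorsion_of_forall_fixed_torsion_eq_zero (D : Subgroup (absoluteGaloisGroup K))
    (h : ∀ P : W.geomTorsion (p : ℤ), (∀ σ ∈ D, σ • P = P) → P = 0) :
    ∀ m : W.geomPrimaryTorsion p, (∀ σ ∈ D, σ • m = m) → p • m = 0 → m = 0 := by
  intro m hm hpm
  have hmtor : ((m : W.geomPrimaryTorsion p) : W.geomPoints) ∈ W.geomTorsion (p : ℤ) :=
    AddSubgroup.torsionBy.nsmul_iff.mpr (by
      rw [← AddSubgroupClass.coe_nsmul, hpm, ZeroMemClass.coe_zero])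
  set P : W.geomTorsion (p : ℤ) := ⟨_, hmtor⟩ with hP
  have hPfix : ∀ σ ∈ D, σ • P = P := fun σ hσ ↦ Subtype.ext (by
    rw [AddSubgroup.torsionBy.coe_smul, hP]
    have h' := congrArg (fun z : W.geomPrimaryTorsion p ↦ (z : W.geomPoints)) (hm σ hσ)
    simpa only [primaryComponent.coe_smul] using h')
  have hP0 : P = 0 := h P hPfix
  apply Subtype.ext
  have h' := congrArg (fun z : W.geomTorsion (p : ℤ) ↦ (z : W.geomPoints)) hP0
  simpa only [hP, ZeroMemClass.coe_zero] using h'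

omit [NumberField K] [Fact p.Prime] in
/-- **No fixed point in `E[p]` from none in `S` and none in `E[p]/S`** for a `Γ_K`-stable `S ≤ E[p]` and any subgroup `D`:
a `D`-fixed `P` has `D`-fixed image in `E[p]/S`, hence lies in `S`, where it is `D`-fixed. [folklore] -/
theorem forall_fixed_torsion_eq_zero_of_stableSubgroup (D : Subgroup (absoluteGaloisGroup K))
    (S : StableSubgroup (absoluteGaloisGroup K) (W.geomTorsion (p : ℤ)))
    (hsub : ∀ x : S.Sub, (∀ σ ∈ D, σ • x = x) → x = 0) (hquot : ∀ y : S.Quot, (∀ σ ∈ D, σ • y = y) → y = 0) :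
    ∀ P : W.geomTorsion (p : ℤ), (∀ σ ∈ D, σ • P = P) → P = 0 := by
  intro P hP
  have hq : S.proj P = 0 := hquot _ fun σ hσ ↦ by rw [← S.proj_smul, hP σ hσ]
  obtain ⟨x, hx⟩ := AddMonoidHom.mem_range.mp (S.mem_range_incl_of_proj_eq_zero P hq)
  have hxfix : ∀ σ ∈ D, σ • x = x := fun σ hσ ↦ S.incl_injective (by rw [S.incl_smul, hx, hP σ hσ])
  rw [← hx, hsub x hxfix, map_zero]

end Fixed

/-! ### §2 The non-split multiplicative datum: both clauses, and (L) -/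

section Nonsplit

/-- **At a NON-SPLIT multiplicative odd Eisenstein prime, the base-changed rational line `S ≤ E_K[p]` has no non-zero
`ker κ ⊓ D_{v̄}`-fixed vector in `S` NOR in `E_K[p]/S`** (`K` imaginary quadratic, `(p)` split, `v̄ ∣ p`, any `ℤ_p`-extension `κ`):
p626493 §1 (both `D_𝔓`-clauses at every `𝔓 ∣ p`), CHL `LineBaseChange` (transport to `D_{v̄}`), `TowerFixed` (to `ker κ ⊓ D_{v̄}`).
[cite: GreenbergVatsal2000, §2 pp. 14–15] [cite: SilvermanATAEC1994, Ch. V Thm. 5.3, Cor. 5.4] [cite: SerreGaloisCohomology1997, I.§1.4] -/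
theorem exists_stableSubgroup_noFixed_sub_quot_of_not_split
    {p : ℕ} [hp : Fact p.Prime] (W : WeierstrassCurve ℚ) [W.IsElliptic] [W.IsGloballyMinimal]
    (K : Type) [Field K] [NumberField K] (vbar : HeightOneSpectrum (𝓞 K)) (κ : ZpExtension K p)
    (hp2 : 2 < p) (hmult : Mult W p) (hns : ¬ W.HasSplitMultiplicativeReductionAtPrime p)
    (hred : Red W p) (hK : IsImaginaryQuadratic K)
    (hsplit : ((Ideal.span {(p : ℤ)}).primesOver (𝓞 K)).ncard = 2)
    (hvbar : ((p : ℕ) : 𝓞 K) ∈ vbar.asIdeal) :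
    ∃ S : StableSubgroup (absoluteGaloisGroup K) ((W.baseChange K).geomTorsion ((p : ℕ) : ℤ)),
      Nat.card S.Sub = p ∧ Nat.card S.Quot = p ∧
        (∀ x : S.Sub, (∀ g : ↥(κ.kerSubgroup ⊓ decomp vbar), g • x = x) → x = 0) ∧
        (∀ y : S.Quot, (∀ g : ↥(κ.kerSubgroup ⊓ decomp vbar), g • y = y) → y = 0) := by
  have hpp : p.Prime := hp.out
  have hp2' : p ≠ 2 := by omega
  haveI hEK : (W.baseChange K).IsElliptic := inferInstanceAs (W.map (algebraMap ℚ K)).IsElliptic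
  haveI : IsGalois ℚ K := isGalois_of_finrank_eq_two K hK.1
  have he : vbar.asIdeal.ramificationIdx (𝓞 ℚ) = 1 :=
    ramificationIdx_eq_one_of_card_primesOver K p hK.1 hsplit vbar hvbar
  have hf : vbar.asIdeal.inertiaDeg (𝓞 ℚ) = 1 :=
    inertiaDeg_eq_one_of_card_primesOver K p hK.1 hsplit vbar hvbar
  set v : HeightOneSpectrum (𝓞 ℚ) := vbar.under (𝓞 ℚ) with hv
  have hw : vbar.asIdeal.under (𝓞 ℚ) = v.asIdeal := by rw [hv, HeightOneSpectrum.under_asIdeal]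
  have hpv : ((p : ℕ) : 𝓞 ℚ) ∈ v.asIdeal := natCast_mem_under K p vbar hvbar
  obtain ⟨Φ, hΦ⟩ := exists_isRationalLine_of_not_irr W p hred
  have hcell : ∀ 𝔓 ∈ v.primesAbove,
      (¬ ∀ g ∈ 𝔓.decompositionSubgroup (absoluteGaloisGroup ℚ), ∀ P ∈ Φ, g • P = P) ∧
        (¬ ∀ g ∈ 𝔓.decompositionSubgroup (absoluteGaloisGroup ℚ),
          ∀ P : geomTorsion W (p : ℤ), g • P - P ∈ Φ) :=
    fun 𝔓 h𝔓 ↦ KellerYinLemma511NonsplitOfPrint.not_fix_and_not_quot_of_not_split_of_mem_primesAbove W p hp2'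
      hmult hns hpv hΦ h𝔓
  obtain ⟨t, ht⟩ := exists_geomTorsion_baseChange_equiv W K ((p : ℕ) : ℤ)
  have ht' : ∀ (σ : absoluteGaloisGroup K) (P : W.geomTorsion ((p : ℕ) : ℤ)),
      t (absGaloisRestrict ℚ K σ • P) = σ • t P := fun σ P ↦ by
    rw [← resGal_eq_absGaloisRestrict]; exact ht σ P
  obtain ⟨S, hS, hcardS⟩ := exists_stableSubgroup_corr Φ t ht' hΦ.2
  have hSub : Nat.card S.Sub = p := by rw [hcardS, hΦ.1]
  have hEp : Nat.card ((W.baseChange K).geomTorsion ((p : ℕ) : ℤ)) = p ^ 2 :=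
    (W.baseChange K).natCard_geomTorsion_prime_eq_sq hpp
  have hQuot : Nat.card S.Quot = p := by
    have h := S.natCard_eq_mul
    rw [hEp, hSub, sq] at h
    exact (Nat.eq_of_mul_eq_mul_right hpp.pos h).symm
  have hnon1 : ¬ ∀ γ ∈ decomp vbar, ∀ x : S.Sub, γ • x = x :=
    not_forall_decomp_smul_sub_eq_of_corr Φ t ht' S hS
      (not_forall_decomp_smul_eq K Φ hw he hf fun 𝔓 h𝔓 ↦ (hcell 𝔓 h𝔓).1)
  have hnon2 : ¬ ∀ γ ∈ decomp vbar, ∀ y : S.Quot, γ • y = y :=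
    not_forall_decomp_smul_quot_eq_of_corr Φ t ht' S hS
      (not_forall_decomp_smul_sub_mem K Φ hw he hf fun 𝔓 h𝔓 ↦ (hcell 𝔓 h𝔓).2)
  exact ⟨S, hSub, hQuot, eq_zero_of_fixed_of_not_forall_decomp_smul_eq κ vbar hSub hnon1,
    eq_zero_of_fixed_of_not_forall_decomp_smul_eq κ vbar hQuot hnon2⟩

/-- **(L) at a NON-SPLIT multiplicative odd Eisenstein prime, for free**: no non-zero `p`-torsion element of `E_K[p^∞]` is fixed
by `ker κ ⊓ D_{v̄}` (any `ℤ_p`-extension `κ`; `K` imaginary quadratic with `(p)` split, `v̄ ∣ p`).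
[cite: GreenbergVatsal2000, §2 pp. 14–15, 26] [cite: SilvermanATAEC1994, Ch. V Thm. 5.3, Cor. 5.4] -/
theorem noFixedPTorsion_of_not_split
    {p : ℕ} [hp : Fact p.Prime] (W : WeierstrassCurve ℚ) [W.IsElliptic] [W.IsGloballyMinimal]
    (K : Type) [Field K] [NumberField K] (vbar : HeightOneSpectrum (𝓞 K)) (κ : ZpExtension K p)
    (hp2 : 2 < p) (hmult : Mult W p) (hns : ¬ W.HasSplitMultiplicativeReductionAtPrime p)
    (hred : Red W p) (hK : IsImaginaryQuadratic K)
    (hsplit : ((Ideal.span {(p : ℤ)}).primesOver (𝓞 K)).ncard = 2)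
    (hvbar : ((p : ℕ) : 𝓞 K) ∈ vbar.asIdeal) :
    ∀ m : (W.baseChange K).geomPrimaryTorsion p,
      (∀ σ ∈ κ.kerSubgroup ⊓ decomp vbar, σ • m = m) → p • m = 0 → m = 0 := by
  haveI hEK : (W.baseChange K).IsElliptic := inferInstanceAs (W.map (algebraMap ℚ K)).IsElliptic
  obtain ⟨S, -, -, hsub, hquot⟩ := exists_stableSubgroup_noFixed_sub_quot_of_not_split W K vbar κ hp2 hmult hns hred hK
    hsplit hvbar
  have h := forall_fixed_torsion_eq_zero_of_stableSubgroup (W.baseChange K) (κ.kerSubgroup ⊓ decomp vbar) S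
    (fun x hx ↦ hsub x fun g ↦ hx g.1 g.2) (fun y hy ↦ hquot y fun g ↦ hy g.1 g.2)
  have h' := noFixedPTorsion_of_forall_fixed_torsion_eq_zero (W.baseChange K) (κ.kerSubgroup ⊓ decomp vbar) h
  intro m hm hpm
  exact h' m hm hpm

end Nonsplit

/-! ### §3 The residual λ-count at a non-split datum, conditional on CGLS22 Prop. 14 ALONE -/

section OfPrint

/-- **CGLS22 Prop. 14 ⟹ `p^{λ(X^{Sf})} · #X^{Sf}[p] ≤ #R(S) · #R(E_K[p]/S)` at every NON-SPLIT multiplicative Eisenstein datum of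
Keller–Yin Lemma 5.1.1, and `=` given the residual surjectivity** — file 5's `pow_lambdaInvariant_mul_le_and_eq_of_prop14_of_not_split`
with its hypothesis (L) discharged by §2. Binders: `W/ℚ` globally minimal, `2 < p`, `p ‖ N` non-split, `E[p]` reducible; `K` imaginary
quadratic, Heegner for `N_E`, `(p)` split; `v̄ ∋ p`; `κ` anticyclotomic with generator `γ`; `Sf` = the places of `K` over `N_E` off `p`;
`X^{Sf} = AcSelmer.XAc (E_K) p κ v̄ ↑Sf γ` (= Keller–Yin's `𝔛^S_f`); `hfact` = the PUBLISHED named fact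
`CastellaGrossiLeeSkinner2022.prop14_residualCharacterSelmer_finite`. The «`≤`» is thus the non-split half of Keller–Yin Thm. 1.4.1's
`λ`-clause in residual currency at PUBLISHED tier + kernel; the identity waits on the residual surjectivity only.
[cite: CastellaGrossiLeeSkinner2022, §1.2 Prop. 14, Thm. 3.2.1 (arXiv:2008.02571)] [cite: KellerYin2024, Thm. 1.4.1, Lemma 5.1.1 (arXiv:2402.12781v2)] -/
theorem pow_lambdaInvariant_mul_le_and_eq_of_prop14_of_not_split'
    (hfact : prop14_residualCharacterSelmer_finite)
    {p : ℕ} [hp : Fact p.Prime] (W : WeierstrassCurve ℚ) [W.IsElliptic] [W.IsGloballyMinimal]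
    (K : Type) [Field K] [NumberField K] (vbar : HeightOneSpectrum (𝓞 K))
    (κ : ZpExtension K p) (γ : absoluteGaloisGroup K) [Fact (κ.IsTopGenerator γ)]
    (Sf : Finset (HeightOneSpectrum (𝓞 K)))
    (hp2 : 2 < p) (hmult : Mult W p) (hns : ¬ W.HasSplitMultiplicativeReductionAtPrime p)
    (hred : Red W p) (hK : IsImaginaryQuadratic K)
    (hH : SatisfiesHeegnerHypothesis (W.conductorNorm ℤ) K)
    (hsplit : ((Ideal.span {(p : ℤ)}).primesOver (𝓞 K)).ncard = 2)
    (hvbar : ((p : ℕ) : 𝓞 K) ∈ vbar.asIdeal) (hκ : κ.IsAnticyclotomic)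
    (hSf : ∀ w : HeightOneSpectrum (𝓞 K), w ∈ Sf ↔
      (((W.conductorNorm ℤ : ℤ) : 𝓞 K) ∈ w.asIdeal ∧ ((p : ℕ) : 𝓞 K) ∉ w.asIdeal)) :
    ∃ S : StableSubgroup (absoluteGaloisGroup K) ((W.baseChange K).geomTorsion ((p : ℕ) : ℤ)),
      Nat.card S.Sub = p ∧ Nat.card S.Quot = p ∧
        (∀ y : S.Quot, (∀ g : ↥(κ.kerSubgroup ⊓ decomp vbar), g • y = y) → y = 0) ∧
        p ^ lambdaInvariant p (XAc (W.baseChange K) p κ vbar (↑Sf : Set (HeightOneSpectrum (𝓞 K))) γ) *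
            Nat.card {x : XAc (W.baseChange K) p κ vbar (↑Sf : Set (HeightOneSpectrum (𝓞 K))) γ // p • x = 0} ≤
          Nat.card (datumStrictSelmer κ.kerSubgroup S.Sub p (AcSelmer.bdpData S.Sub p vbar)
              (↑Sf : Set (HeightOneSpectrum (𝓞 K)))) *
            Nat.card (datumStrictSelmer κ.kerSubgroup S.Quot p (AcSelmer.bdpData S.Quot p vbar)
              (↑Sf : Set (HeightOneSpectrum (𝓞 K)))) ∧
        ((∀ z ∈ datumStrictSelmer κ.kerSubgroup S.Quot p (AcSelmer.bdpData S.Quot p vbar)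
              (↑Sf : Set (HeightOneSpectrum (𝓞 K))),
            ∃ y ∈ datumStrictSelmer κ.kerSubgroup ((W.baseChange K).geomTorsion ((p : ℕ) : ℤ)) p
              (AcSelmer.bdpData _ p vbar) (↑Sf : Set (HeightOneSpectrum (𝓞 K))),
              resH1Hom (ContinuousMonoidHom.id κ.kerSubgroup) S.proj (fun _ b ↦ S.proj_smul _ b) y = z) →
          p ^ lambdaInvariant p (XAc (W.baseChange K) p κ vbar (↑Sf : Set (HeightOneSpectrum (𝓞 K))) γ) *
              Nat.card {x : XAc (W.baseChange K) p κ vbar (↑Sf : Set (HeightOneSpectrum (𝓞 K))) γ // p • x = 0} =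
            Nat.card (datumStrictSelmer κ.kerSubgroup S.Sub p (AcSelmer.bdpData S.Sub p vbar)
                (↑Sf : Set (HeightOneSpectrum (𝓞 K)))) *
              Nat.card (datumStrictSelmer κ.kerSubgroup S.Quot p (AcSelmer.bdpData S.Quot p vbar)
                (↑Sf : Set (HeightOneSpectrum (𝓞 K))))) :=
  pow_lambdaInvariant_mul_le_and_eq_of_prop14_of_not_split hfact W K vbar κ γ Sf hp2 hmult hns hred hK hH hsplit hvbar hκ hSf
    (noFixedPTorsion_of_not_split W K vbar κ hp2 hmult hns hred hK hsplit hvbar)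

end OfPrint

end Summit.BirchSwinnertonDyer.BirchSwinnertonDyer.Theorems.ResidualDevissageNonsplitLocal

end
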